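import Summits.Parity.GeneralizedHardyLittlewood.Theorems.GreenTaoLevelTwoGITwoCyclicInverseBohrAveraging
import Summits.Parity.GeneralizedHardyLittlewood.Theorems.GreenTaoLevelTwoGITwoCyclicInverseBohrRegularPrelims
import Mathlib.Analysis.Complex.Basic

/-!
# Route `GreenTaoLevelTwo`, crux `GITwo` (stmt-Parity-21275), line `birth`, stub `stub_cyclicInverse`:
# GT08a §9 Step 3 — localising the inner variable to a smaller Bohr set and pigeonholing

Fifty-fourth helper file toward the XL stub `stub_cyclicInverse` (B. Green, T. Tao, *An inverse
theorem for the Gowers `U³(G)` norm*, arXiv:math/0503014, Thm. 68 = PEMS 51 (2008) Thm. 12.8).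
Block C13, §9 Step 3, displays "It is convenient to localize `x` further … By Lemma (avg) (ii) …
By the pigeonhole principle there exists `w ∈ B₄` such that …": inside a `y`-indexed family of
double sums `Σ_{h∈B₄} b'(y,h) Σ_{x∈B₄} G(y,h,x)` (`B₄ = B(S₃,ρ₄)` regular, `‖b'‖, ‖G‖ ≤ 1`) the inner
`x`-sum is replaced by an average of sums over translates `x₀ + B₅` (`B₅` a set of small shifts,
arXiv Lemma 21 (ii) `norm_sum_sub_sum_avg_le_of_regular`), and a good `x₀ ∈ B₄` is pigeonholed
uniformly in `y`:
`(K #B₅ − 200 d ε N #B₄² #B₅)/#B₄ ≤ Σ_y |Σ_{h∈B₄} b'(y,h) Σ_{w∈B₅} G(y,h,x₀+w)|`.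

* `exists_localised_family` — the statement above, for abstract bounded `G`.

References: [GreenTao2008U3Inverse] arXiv:math/0503014, §9 Step 3.
-/

noncomputable section

namespace Summit.Parity.GeneralizedHardyLittlewood.GreenTaoLevelTwoGITwoCyclicInverse

open Finset

variable {N : ℕ} [NeZero N]

/-- **GT08a §9 Step 3, localisation + pigeonhole.**  Let `S₃` be nonempty (`d = #S₃`), `ρ₄ > 0`,
`B₄ = B(S₃,ρ₄)` regular, `0 < ε ≤ 1/(100d)`, `B₅` a finset with `‖wξ‖ ≤ ερ₄` (`ξ ∈ S₃`, `w ∈ B₅`),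
`G : ℤ/Nℤ → ℤ/Nℤ → ℤ/Nℤ → ℂ` and `b' : ℤ/Nℤ → ℤ/Nℤ → ℂ` bounded by `1`, and
`K ≤ Σ_y |Σ_{h∈B₄} b'(y,h) Σ_{x∈B₄} G(y,h,x)|`.  Then some `x₀ ∈ B₄` has
`K #B₅ − 200 d ε N #B₄² #B₅ ≤ #B₄ · Σ_y |Σ_{h∈B₄} b'(y,h) Σ_{w∈B₅} G(y,h,x₀+w)|`.
[cite: GreenTao2008U3Inverse, §9 Step 3] -/
theorem exists_localised_family (S₃ : Finset (ZMod N)) (hS : S₃.Nonempty) {ρ₄ ε : ℝ} (hρ : 0 < ρ₄)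
    (hε0 : 0 < ε) (hε100 : ε ≤ 1 / (100 * (#S₃ : ℝ)))
    (hreg : ∀ r : ℝ, |r| ≤ 1 / (100 * (#S₃ : ℝ)) →
      (1 - 100 * (#S₃ : ℝ) * |r|) * #{x : ZMod N | ∀ ξ ∈ S₃, ‖ZMod.toAddCircle (x * ξ)‖ < ρ₄} ≤
          #{x : ZMod N | ∀ ξ ∈ S₃, ‖ZMod.toAddCircle (x * ξ)‖ < (1 + r) * ρ₄} ∧
        (#{x : ZMod N | ∀ ξ ∈ S₃, ‖ZMod.toAddCircle (x * ξ)‖ < (1 + r) * ρ₄} : ℝ) ≤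
          (1 + 100 * (#S₃ : ℝ) * |r|) * #{x : ZMod N | ∀ ξ ∈ S₃, ‖ZMod.toAddCircle (x * ξ)‖ < ρ₄})
    {B₅ : Finset (ZMod N)} (hB₅ : ∀ w ∈ B₅, ∀ ξ ∈ S₃, ‖ZMod.toAddCircle (w * ξ)‖ ≤ ε * ρ₄)
    (G : ZMod N → ZMod N → ZMod N → ℂ) (hG : ∀ y h x, ‖G y h x‖ ≤ 1)
    (b' : ZMod N → ZMod N → ℂ) (hb' : ∀ y h, ‖b' y h‖ ≤ 1) {K : ℝ}
    (hK : K ≤ ∑ y : ZMod N, ‖∑ h ∈ ({x : ZMod N | ∀ ξ ∈ S₃, ‖ZMod.toAddCircle (x * ξ)‖ < ρ₄} :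
      Finset (ZMod N)), b' y h * ∑ x ∈ ({x : ZMod N | ∀ ξ ∈ S₃, ‖ZMod.toAddCircle (x * ξ)‖ < ρ₄} :
        Finset (ZMod N)), G y h x‖) :
    ∃ x₀ ∈ ({x : ZMod N | ∀ ξ ∈ S₃, ‖ZMod.toAddCircle (x * ξ)‖ < ρ₄} : Finset (ZMod N)),
      K * #B₅ - 200 * (#S₃ : ℝ) * ε * N *
          (#{x : ZMod N | ∀ ξ ∈ S₃, ‖ZMod.toAddCircle (x * ξ)‖ < ρ₄} : ℝ) ^ 2 * #B₅ ≤
        #{x : ZMod N | ∀ ξ ∈ S₃, ‖ZMod.toAddCircle (x * ξ)‖ < ρ₄} *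
          ∑ y : ZMod N, ‖∑ h ∈ ({x : ZMod N | ∀ ξ ∈ S₃, ‖ZMod.toAddCircle (x * ξ)‖ < ρ₄} :
            Finset (ZMod N)), b' y h * ∑ w ∈ B₅, G y h (x₀ + w)‖ := by
  classical
  set B₄ : Finset (ZMod N) := {x : ZMod N | ∀ ξ ∈ S₃, ‖ZMod.toAddCircle (x * ξ)‖ < ρ₄} with hB₄def
  have hB₄ : ∀ x, x ∈ B₄ ↔ ∀ ξ ∈ S₃, ‖ZMod.toAddCircle (x * ξ)‖ < ρ₄ := fun x => by
    rw [hB₄def, mem_filter]; simp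
  have hc1 : (1 : ℝ) ≤ #B₄ := by exact_mod_cast one_le_card_bohr S₃ hρ
  have hc0 : (0 : ℝ) < #B₄ := by linarith
  have hB₄ne : B₄.Nonempty := by
    rw [← card_pos]; have : (0 : ℝ) < #B₄ := hc0
    exact_mod_cast this
  -- regularity of `B₄` at `±ε`
  set Bp : Finset (ZMod N) := {x : ZMod N | ∀ ξ ∈ S₃, ‖ZMod.toAddCircle (x * ξ)‖ < (1 + ε) * ρ₄}
    with hBpdef
  set Bm : Finset (ZMod N) := {x : ZMod N | ∀ ξ ∈ S₃, ‖ZMod.toAddCircle (x * ξ)‖ < (1 - ε) * ρ₄}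
    with hBmdef
  have hBp : ∀ x, x ∈ Bp ↔ ∀ ξ ∈ S₃, ‖ZMod.toAddCircle (x * ξ)‖ < (1 + ε) * ρ₄ := fun x => by
    rw [hBpdef, mem_filter]; simp
  have hBm : ∀ x, x ∈ Bm ↔ ∀ ξ ∈ S₃, ‖ZMod.toAddCircle (x * ξ)‖ < (1 - ε) * ρ₄ := fun x => by
    rw [hBmdef, mem_filter]; simp
  have hregp : (#Bp : ℝ) ≤ (1 + 100 * (#S₃ : ℝ) * ε) * #B₄ := by
    have h := (hreg ε (by rw [abs_of_pos hε0]; exact hε100)).2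
    rw [abs_of_pos hε0] at h; exact h
  have hregm : (1 - 100 * (#S₃ : ℝ) * ε) * #B₄ ≤ (#Bm : ℝ) := by
    have h := (hreg (-ε) (by rw [abs_neg, abs_of_pos hε0]; exact hε100)).1
    rw [abs_neg, abs_of_pos hε0, ← sub_eq_add_neg] at h; exact h
  -- arXiv Lemma 21 (ii) for each `(y, h)`
  have h21 : ∀ y h, ‖(#B₅ : ℂ) * ∑ x ∈ B₄, G y h x - ∑ x ∈ B₄, ∑ w ∈ B₅, G y h (x + w)‖ ≤
      200 * (#S₃ : ℝ) * ε * #B₅ * #B₄ := fun y h =>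
    norm_sum_sub_sum_avg_le_of_regular hB₄ hBp hBm hS hB₅ hregp hregm (hG y h)
  -- for each `y`, compare the two `h`-sums
  have hy : ∀ y, (#B₅ : ℝ) * ‖∑ h ∈ B₄, b' y h * ∑ x ∈ B₄, G y h x‖ ≤
      ‖∑ h ∈ B₄, b' y h * ∑ x ∈ B₄, ∑ w ∈ B₅, G y h (x + w)‖ +
        200 * (#S₃ : ℝ) * ε * #B₅ * (#B₄ : ℝ) ^ 2 := by
    intro y
    have h1 : (#B₅ : ℝ) * ‖∑ h ∈ B₄, b' y h * ∑ x ∈ B₄, G y h x‖ =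
        ‖∑ h ∈ B₄, b' y h * ((#B₅ : ℂ) * ∑ x ∈ B₄, G y h x)‖ := by
      rw [← Complex.norm_natCast, ← norm_mul, mul_sum]
      congr 1
      exact sum_congr rfl fun h _ => by ring
    have h2 : ‖∑ h ∈ B₄, b' y h * ((#B₅ : ℂ) * ∑ x ∈ B₄, G y h x) -
        ∑ h ∈ B₄, b' y h * ∑ x ∈ B₄, ∑ w ∈ B₅, G y h (x + w)‖ ≤
        200 * (#S₃ : ℝ) * ε * #B₅ * (#B₄ : ℝ) ^ 2 := by
      rw [← sum_sub_distrib]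
      refine (norm_sum_le _ _).trans ?_
      calc ∑ h ∈ B₄, ‖b' y h * ((#B₅ : ℂ) * ∑ x ∈ B₄, G y h x) -
              b' y h * ∑ x ∈ B₄, ∑ w ∈ B₅, G y h (x + w)‖
          ≤ ∑ h ∈ B₄, 200 * (#S₃ : ℝ) * ε * #B₅ * #B₄ := sum_le_sum fun h _ => by
            rw [← mul_sub, norm_mul]
            calc ‖b' y h‖ * _ ≤ 1 * (200 * (#S₃ : ℝ) * ε * #B₅ * #B₄) :=
                  mul_le_mul (hb' y h) (h21 y h) (norm_nonneg _) zero_le_one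
              _ = _ := one_mul _
        _ = 200 * (#S₃ : ℝ) * ε * #B₅ * (#B₄ : ℝ) ^ 2 := by rw [sum_const, nsmul_eq_mul]; ring
    have h3 := norm_sub_norm_le (∑ h ∈ B₄, b' y h * ((#B₅ : ℂ) * ∑ x ∈ B₄, G y h x))
      (∑ h ∈ B₄, b' y h * ∑ x ∈ B₄, ∑ w ∈ B₅, G y h (x + w))
    rw [h1]; linarith
  -- sum over `y`
  have hsumy : K * #B₅ - 200 * (#S₃ : ℝ) * ε * N * (#B₄ : ℝ) ^ 2 * #B₅ ≤
      ∑ y : ZMod N, ‖∑ h ∈ B₄, b' y h * ∑ x ∈ B₄, ∑ w ∈ B₅, G y h (x + w)‖ := by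
    have h1 : (#B₅ : ℝ) * K ≤ ∑ y : ZMod N, (#B₅ : ℝ) * ‖∑ h ∈ B₄, b' y h * ∑ x ∈ B₄, G y h x‖ := by
      rw [← mul_sum]; exact mul_le_mul_of_nonneg_left hK (Nat.cast_nonneg _)
    have h2 := sum_le_sum fun y (_ : y ∈ (univ : Finset (ZMod N))) => hy y
    rw [sum_add_distrib, sum_const, card_univ, ZMod.card, nsmul_eq_mul] at h2
    linarith
  -- exchange `x` to the outside and pigeonhole
  have hswap : ∀ y, ∑ h ∈ B₄, b' y h * ∑ x ∈ B₄, ∑ w ∈ B₅, G y h (x + w) =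
      ∑ x ∈ B₄, ∑ h ∈ B₄, b' y h * ∑ w ∈ B₅, G y h (x + w) := fun y => by
    rw [Finset.sum_comm]
    exact sum_congr rfl fun h _ => by rw [mul_sum]
  have htri : ∑ y : ZMod N, ‖∑ h ∈ B₄, b' y h * ∑ x ∈ B₄, ∑ w ∈ B₅, G y h (x + w)‖ ≤
      ∑ x ∈ B₄, ∑ y : ZMod N, ‖∑ h ∈ B₄, b' y h * ∑ w ∈ B₅, G y h (x + w)‖ := by
    rw [Finset.sum_comm]
    exact sum_le_sum fun y _ => by rw [hswap y]; exact norm_sum_le _ _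
  obtain ⟨x₀, hx₀, hbest⟩ := exists_max_image B₄
    (fun x => ∑ y : ZMod N, ‖∑ h ∈ B₄, b' y h * ∑ w ∈ B₅, G y h (x + w)‖) hB₄ne
  refine ⟨x₀, hx₀, ?_⟩
  have hmax : ∑ x ∈ B₄, ∑ y : ZMod N, ‖∑ h ∈ B₄, b' y h * ∑ w ∈ B₅, G y h (x + w)‖ ≤
      #B₄ * ∑ y : ZMod N, ‖∑ h ∈ B₄, b' y h * ∑ w ∈ B₅, G y h (x₀ + w)‖ := by
    calc _ ≤ ∑ _x ∈ B₄, ∑ y : ZMod N, ‖∑ h ∈ B₄, b' y h * ∑ w ∈ B₅, G y h (x₀ + w)‖ :=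
          sum_le_sum fun x hx => hbest x hx
      _ = _ := by rw [sum_const, nsmul_eq_mul]
  linarith

end Summit.Parity.GeneralizedHardyLittlewood.GreenTaoLevelTwoGITwoCyclicInverse
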